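import Mathlib.Algebra.BigOperators.Group.Finset.Basic
import Mathlib.Algebra.BigOperators.Fin
import Mathlib.Algebra.MvPolynomial.Eval
import Mathlib.Data.Nat.Log
import Mathlib.Logic.Equiv.Fin.Basic
import Literature.Computability.AlgebraicComplexity.ArithCircuit
import Literature.Computability.AlgebraicComplexity.ArithCircuitProofs
import HarnessLib

/-!
# The cost calculus of the constant-free complexity `τ` (Bürgisser 2000 §1.4; Malod 2003)

Companion ("Proofs") file of `Literature.Computability.AlgebraicComplexity.ArithCircuit` for the
constant-free measure `constantFreeComplexity` (`τ`: least size of a fan-in-two circuit with all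
constants and sum coefficients in `{0, 1, -1}`), which the tree so far only *defines*. We prove,
from the definitions alone:

* closure of `HasSignConstants` under the circuit combinators (`ofVar`, `ofConst c` for `c ∈ {0, 1, -1}`,
  `append`, `add`, `mul`, `smul (±1)`, `rename`);
* `ArithCircuit.exists_computes_hasSignConstants_holds` — **discharge** of the named fact
  `ArithCircuit.exists_computes_hasSignConstants`: every integer polynomial has a fan-in-two
  constant-free circuit (integers are iterated sums of `1`), so `τ f` is attained over `ℤ`
  (`exists_computes_size_eq_constantFreeComplexity`);
* `complexity_le_constantFreeComplexity_holds` — **discharge** of the named fact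
  `complexity_le_constantFreeComplexity` (`L(f) ≤ τ(f)`);
* the cost calculus: `τ(f + g), τ(f g) ≤ τ f + τ g + 1`, `τ(-f) ≤ τ f + 1`,
  `τ(f - g) ≤ τ f + τ g + 2`, `τ(X i) = τ(1) = τ(0) = 0`, `τ(2) ≤ 1`, `τ(f²) ≤ τ f + 1`,
  `τ(f^(2^i)) ≤ τ f + i` (repeated squaring), `τ(2^m) ≤ 3 (log₂ m + 1)`,
  `τ(∑_{i ∈ s} fᵢ), τ(∏_{i ∈ s} fᵢ) ≤ ∑ τ(fᵢ) + #s`, `τ(rename e f) ≤ τ f`;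
* the **substitution bound** `constantFreeComplexity_aeval_le`:
  `τ(f(g₁, …, g_m)) ≤ τ(f) + ∑ᵢ τ(gᵢ)` (plug the circuits of the `gᵢ` into the inputs of a
  circuit for `f`; Bürgisser 2000, proof of Prop. 2.3 / Rem. 2.7 for `L`, verbatim for `τ`).

These are the ingredients of Bürgisser's estimate
`τ(2^{e(n)} f_n) ≤ τ(2^{e(n)} G) + ℓ(n) + λ(n)` in the proof of Thm. 4.1(2) of
*On defining integers and proving arithmetic circuit lower bounds* (2009)
(`BurgisserThm41Proofs.lean`).

## Design notes

* The semantics of `add`/`mul`/`append` (`eval_add`, `eval_mul`, `gateValues_append`) are named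
  facts in `ArithCircuit.lean` whose discharges live in a `Problems/` file that `Literature/`
  cannot import, and as `private` lemmas in `ArithCircuitProofs.lean`; we re-prove them here
  under the fresh public names `ArithCircuit.gateValues_append_gates`, `ArithCircuit.add_eval`,
  `ArithCircuit.mul_eval` (no clash with the `Problems/` twins `gateValues_append_holds`,
  `eval_add_holds`, `eval_mul_holds`).
* Substitution is the circuit `substCircuit P pre ρ`: a prefix gate list `pre` followed by the
  gates of `P` with every variable `X i` replaced by the operand `ρ i` (reading the prefix) and
  every gate reference shifted past the prefix; `juxtGates`/`juxtOuts` juxtapose a list of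
  circuits into one prefix with stable output operands.
* All `τ`-bounds are over `ℤ` (where `τ` is attained); the structural lemmas are over a general
  commutative semiring.

## References

* P. Bürgisser, *Completeness and Reduction in Algebraic Complexity Theory*, Springer 2000,
  Def. 2.1, §1.4 (constant-free model), proof of Prop. 2.3, Rem. 2.7 (substitution).
* G. Malod, *Polynômes et coefficients*, PhD thesis, Lyon 2003 (calculs sans constantes).
* P. Bürgisser, *On defining integers and proving arithmetic circuit lower bounds*,
  Comput. Complexity 18 (2009) 81–103, §2.2 (`τ`, `log log k ≤ τ(k) ≤ 2 log k`).
* P. Koiran, *Valiant's model and the cost of computing integers*, Comput. Complexity 13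
  (2004), §1 (`τ(2^{2^k}) = k + 1` by repeated squaring).
-/

noncomputable section

open MvPolynomial

namespace Literature.Computability.AlgebraicComplexity

universe u v w

namespace ArithCircuit

variable {k : Type u} {σ : Type v} {τ : Type w}

/-! ### Sign constants of the combinators -/

section SignConstants

variable [Zero k] [One k] [Add k]

/-- `0 ∈ {0, 1, -1}`. [cite: Burgisser2000, §1.4] -/
theorem isSignConstant_zero : IsSignConstant (0 : k) := Or.inl rfl

/-- `1 ∈ {0, 1, -1}`. [cite: Burgisser2000, §1.4] -/
theorem isSignConstant_one : IsSignConstant (1 : k) := Or.inr (Or.inl rfl)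

/-- Variables carry no constants. [cite: Burgisser2000, §1.4] -/
theorem Operand.hasSignConstants_var (i : σ) : (Operand.var i : Operand k σ).HasSignConstants :=
  trivial

/-- Gate references carry no constants. [cite: Burgisser2000, §1.4] -/
theorem Operand.hasSignConstants_gate (j : ℕ) : (Operand.gate j : Operand k σ).HasSignConstants :=
  trivial

/-- A constant operand has sign constants iff the constant lies in `{0, 1, -1}`. [cite: Burgisser2000, §1.4] -/
theorem Operand.hasSignConstants_const_iff (c : k) :
    (Operand.const c : Operand k σ).HasSignConstants ↔ IsSignConstant c := Iff.rfl

/-- Shifting gate references preserves sign constants. [folklore] -/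
theorem Operand.HasSignConstants.shift {u : Operand k σ} (h : u.HasSignConstants) (n : ℕ) :
    (u.shift n).HasSignConstants := by
  cases u with
  | var i => trivial
  | const c => exact h
  | gate j => trivial

/-- Truncation preserves sign constants (a truncated junk reference becomes `const 0`). [folklore] -/
theorem Operand.HasSignConstants.truncate {u : Operand k σ} (h : u.HasSignConstants) (n : ℕ) :
    (u.truncate n).HasSignConstants := by
  cases u with
  | var i => trivial
  | const c => exact h
  | gate j =>
    by_cases hj : j < n
    · simp only [Operand.truncate, hj, if_true]; trivial
    · simp only [Operand.truncate, hj, if_false]; exact isSignConstant_zero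

/-- Renaming variables preserves sign constants. [folklore] -/
theorem Operand.HasSignConstants.rename {u : Operand k σ} (h : u.HasSignConstants) (e : σ → τ) :
    (u.rename e).HasSignConstants := by
  cases u with
  | var i => trivial
  | const c => exact h
  | gate j => trivial

/-- Shifting gate references preserves sign constants of a gate. [folklore] -/
theorem Gate.HasSignConstants.shift {g : Gate k σ} (h : g.HasSignConstants) (n : ℕ) :
    (g.shift n).HasSignConstants := by
  cases g with
  | sum args =>
    intro a ha
    simp only [List.mem_map] at ha
    obtain ⟨b, hb, rfl⟩ := ha
    exact ⟨(h b hb).1, (h b hb).2.shift n⟩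
  | prod args =>
    intro u hu
    simp only [List.mem_map] at hu
    obtain ⟨v, hv, rfl⟩ := hu
    exact (h v hv).shift n

/-- Renaming variables preserves sign constants of a gate. [folklore] -/
theorem Gate.HasSignConstants.rename {g : Gate k σ} (h : g.HasSignConstants) (e : σ → τ) :
    (g.rename e).HasSignConstants := by
  cases g with
  | sum args =>
    intro a ha
    simp only [List.mem_map] at ha
    obtain ⟨b, hb, rfl⟩ := ha
    exact ⟨(h b hb).1, (h b hb).2.rename e⟩
  | prod args =>
    intro u hu
    simp only [List.mem_map] at hu
    obtain ⟨v, hv, rfl⟩ := hu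
    exact (h v hv).rename e

/-- The input circuit `ofVar i` is constant-free. [cite: Burgisser2000, §1.4] -/
theorem HasSignConstants.ofVar (i : σ) : (ofVar i : ArithCircuit k σ).HasSignConstants :=
  ⟨fun g hg => by simp [ArithCircuit.ofVar] at hg, trivial⟩

/-- `ofConst c` is constant-free iff `c ∈ {0, 1, -1}`. [cite: Burgisser2000, §1.4] -/
theorem hasSignConstants_ofConst_iff (c : k) :
    (ofConst c : ArithCircuit k σ).HasSignConstants ↔ IsSignConstant c :=
  ⟨fun h => h.2, fun h => ⟨fun g hg => by simp [ArithCircuit.ofConst] at hg, h⟩⟩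

/-- Juxtaposition of constant-free circuits is constant-free. [cite: Burgisser2000, §1.4] -/
theorem HasSignConstants.append {P Q : ArithCircuit k σ} (hP : P.HasSignConstants)
    (hQ : Q.HasSignConstants) : (P.append Q).HasSignConstants := by
  refine ⟨fun g hg => ?_, hQ.2.shift _⟩
  simp only [ArithCircuit.append, List.mem_append, List.mem_map] at hg
  rcases hg with hg | ⟨g', hg', rfl⟩
  · exact hP.1 g hg
  · exact (hQ.1 g' hg').shift _

/-- The product combinator of constant-free circuits is constant-free. [cite: Burgisser2000, §1.4] -/
theorem HasSignConstants.mul {P Q : ArithCircuit k σ} (hP : P.HasSignConstants)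
    (hQ : Q.HasSignConstants) : (P.mul Q).HasSignConstants := by
  refine ⟨fun g hg => ?_, trivial⟩
  simp only [ArithCircuit.mul, List.mem_append, List.mem_singleton] at hg
  rcases hg with hg | rfl
  · exact (hP.append hQ).1 g hg
  · intro u hu
    simp only [List.mem_cons, List.mem_nil_iff, or_false] at hu
    rcases hu with rfl | rfl
    · exact hP.2.truncate _
    · exact hQ.2.shift _

/-- The scalar-multiple combinator by a sign constant is constant-free. [cite: Burgisser2000, §1.4] -/
theorem HasSignConstants.smul {c : k} (hc : IsSignConstant c) {P : ArithCircuit k σ}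
    (hP : P.HasSignConstants) : (P.smul c).HasSignConstants := by
  refine ⟨fun g hg => ?_, trivial⟩
  simp only [ArithCircuit.smul, List.mem_append, List.mem_singleton] at hg
  rcases hg with hg | rfl
  · exact hP.1 g hg
  · intro a ha
    simp only [List.mem_singleton] at ha
    subst ha
    exact ⟨hc, hP.2⟩

/-- Renaming the variables of a constant-free circuit gives a constant-free circuit. [cite: Burgisser2000, §1.4] -/
theorem HasSignConstants.rename {P : ArithCircuit k σ} (hP : P.HasSignConstants) (e : σ → τ) :
    (P.rename e).HasSignConstants := by
  refine ⟨fun g hg => ?_, hP.2.rename e⟩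
  simp only [ArithCircuit.rename, List.mem_map] at hg
  obtain ⟨g', hg', rfl⟩ := hg
  exact (hP.1 g' hg').rename e

end SignConstants

/-- The sum combinator of constant-free circuits is constant-free (its new gate has
coefficients `1, 1`). [cite: Burgisser2000, §1.4] -/
theorem HasSignConstants.add [CommSemiring k] {P Q : ArithCircuit k σ} (hP : P.HasSignConstants)
    (hQ : Q.HasSignConstants) : (P.add Q).HasSignConstants := by
  refine ⟨fun g hg => ?_, trivial⟩
  simp only [ArithCircuit.add, List.mem_append, List.mem_singleton] at hg
  rcases hg with hg | rfl
  · exact (hP.append hQ).1 g hg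
  · intro a ha
    simp only [List.mem_cons, List.mem_nil_iff, or_false] at ha
    rcases ha with rfl | rfl
    · exact ⟨isSignConstant_one, hP.2.truncate _⟩
    · exact ⟨isSignConstant_one, hQ.2.shift _⟩

/-- `-1 ∈ {0, 1, -1}` in a ring. [cite: Burgisser2000, §1.4] -/
theorem isSignConstant_neg_one {R : Type u} [Ring R] : IsSignConstant (-1 : R) :=
  Or.inr (Or.inr (neg_add_cancel 1))

/-! ### Fan-in of the combinators (complements to `ArithCircuitProofs.lean`) -/

/-- Juxtaposition preserves fan-in two. [folklore] -/
theorem IsFanInTwo.append {P Q : ArithCircuit k σ} (hP : P.IsFanInTwo) (hQ : Q.IsFanInTwo) :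
    (P.append Q).IsFanInTwo := by
  intro g hg
  simp only [ArithCircuit.append, List.mem_append, List.mem_map] at hg
  rcases hg with hg | ⟨g', hg', rfl⟩
  · exact hP g hg
  · have : (g'.shift P.size).fanIn = g'.fanIn := by
      cases g' <;> simp [Gate.shift, Gate.fanIn, Gate.args]
    rw [this]
    exact hQ g' hg'

/-! ### The squaring combinator (one product gate reading the same operand twice) -/

/-- The circuit computing `P.eval ^ 2`: `P` followed by one product gate `P.output * P.output`
(sharing: `P` is not duplicated; Koiran 2004, §1, repeated squaring). [cite: Koiran2004, §1] -/
def square (P : ArithCircuit k σ) : ArithCircuit k σ where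
  gates := P.gates ++ [.prod [P.output, P.output]]
  output := .gate P.size

/-- The squaring combinator adds one gate. [cite: Koiran2004, §1] -/
@[simp]
theorem size_square (P : ArithCircuit k σ) : P.square.size = P.size + 1 := by
  simp [square, size]

/-- The squaring combinator preserves fan-in two. [folklore] -/
theorem IsFanInTwo.square {P : ArithCircuit k σ} (hP : P.IsFanInTwo) : P.square.IsFanInTwo := by
  intro g hg
  simp only [ArithCircuit.square, List.mem_append, List.mem_singleton] at hg
  rcases hg with hg | rfl
  · exact hP g hg
  · simp [Gate.fanIn, Gate.args]

section SquareSign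

variable [Zero k] [One k] [Add k]

/-- The squaring combinator preserves sign constants. [cite: Burgisser2000, §1.4] -/
theorem HasSignConstants.square {P : ArithCircuit k σ} (hP : P.HasSignConstants) :
    P.square.HasSignConstants := by
  refine ⟨fun g hg => ?_, trivial⟩
  simp only [ArithCircuit.square, List.mem_append, List.mem_singleton] at hg
  rcases hg with hg | rfl
  · exact hP.1 g hg
  · intro u hu
    simp only [List.mem_cons, List.mem_nil_iff, or_false] at hu
    rcases hu with rfl | rfl <;> exact hP.2

end SquareSign

/-! ### Public semantics of `append` / `add` / `mul` -/

section Semantics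

variable [CommSemiring k]

/-- A shifted gate evaluated against `pre ++ vals` (shift `= pre.length`) reads `vals`. [folklore] -/
theorem Gate.eval_shift_append' (pre vals : List (MvPolynomial σ k)) (g : Gate k σ) :
    (g.shift pre.length).eval (pre ++ vals) = g.eval vals := by
  cases g with
  | sum args =>
    simp [Gate.shift, Gate.eval, List.map_map, Function.comp_def, Operand.eval_shift_append]
  | prod args =>
    simp [Gate.shift, Gate.eval, List.map_map, Function.comp_def, Operand.eval_shift_append]

/-- The left fold over shifted gates with a prefix of values. [folklore] -/
theorem foldl_shift' (pre : List (MvPolynomial σ k)) (gs : List (Gate k σ))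
    (vals : List (MvPolynomial σ k)) :
    (gs.map (Gate.shift pre.length)).foldl (fun vals g => vals ++ [g.eval vals]) (pre ++ vals)
      = pre ++ gs.foldl (fun vals g => vals ++ [g.eval vals]) vals := by
  induction gs generalizing vals with
  | nil => simp
  | cons g rest ih =>
    simp only [List.map_cons, List.foldl_cons]
    rw [Gate.eval_shift_append', List.append_assoc, ih]

/-- The value list of `gs ++ (gs'.map (shift |gs|))` is the concatenation of the value lists
(Bürgisser 2000, proof of Prop. 2.3). [cite: Burgisser2000, proof of Prop. 2.3] -/
theorem gateValues_append_shift (gs gs' : List (Gate k σ)) :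
    gateValues (gs ++ gs'.map (Gate.shift gs.length)) = gateValues gs ++ gateValues gs' := by
  have h : gs.length = (gateValues gs).length := (gateValues_length (k := k) gs).symm
  unfold gateValues
  rw [List.foldl_append, h]
  have := foldl_shift' (k := k) (σ := σ) (gateValues gs) gs' []
  simpa [gateValues] using this

/-- The value list of a sequential composition is the concatenation of the value lists
(Bürgisser 2000, proof of Prop. 2.3; public twin of the named fact `gateValues_append`). [cite: Burgisser2000, proof of Prop. 2.3] -/
theorem gateValues_append_gates (P Q : ArithCircuit k σ) :
    gateValues (P.append Q).gates = gateValues P.gates ++ gateValues Q.gates :=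
  gateValues_append_shift P.gates Q.gates

/-- The sum combinator computes the sum (public twin of the named fact `eval_add`;
Bürgisser 2000, Def. 2.1). [cite: Burgisser2000, Def. 2.1] -/
theorem add_eval (P Q : ArithCircuit k σ) : (P.add Q).eval = P.eval + Q.eval := by
  have hP := gateValues_length (k := k) P.gates
  have hQ := gateValues_length (k := k) Q.gates
  have h1 := Operand.eval_truncate_append (gateValues P.gates) (gateValues Q.gates) P.output
  have h2 := Operand.eval_shift_append (gateValues P.gates) (gateValues Q.gates) Q.output
  rw [hP] at h1 h2
  simp [eval, ArithCircuit.add, gateValues_append_gates, Gate.eval, size,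
    List.getD_eq_getElem?_getD, hP, hQ, h1, h2]

/-- The product combinator computes the product (public twin of the named fact `eval_mul`;
Bürgisser 2000, Def. 2.1). [cite: Burgisser2000, Def. 2.1] -/
theorem mul_eval (P Q : ArithCircuit k σ) : (P.mul Q).eval = P.eval * Q.eval := by
  have hP := gateValues_length (k := k) P.gates
  have hQ := gateValues_length (k := k) Q.gates
  have h1 := Operand.eval_truncate_append (gateValues P.gates) (gateValues Q.gates) P.output
  have h2 := Operand.eval_shift_append (gateValues P.gates) (gateValues Q.gates) Q.output
  rw [hP] at h1 h2
  simp [eval, ArithCircuit.mul, gateValues_append_gates, Gate.eval, size,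
    List.getD_eq_getElem?_getD, hP, hQ, h1, h2]

/-- The squaring combinator computes the square. [cite: Koiran2004, §1] -/
theorem square_eval (P : ArithCircuit k σ) : P.square.eval = P.eval ^ 2 := by
  have h := gateValues_length (k := k) P.gates
  simp [eval, square, gateValues_append_singleton, Gate.eval, size,
    List.getD_eq_getElem?_getD, h, pow_two]

end Semantics

/-! ### Substitution of circuits into the inputs of a circuit -/

section Subst

/-- Substitute the operand `ρ i` for every variable `X i` and shift every gate reference by `n`
(the length of the prefix the operands `ρ i` read). [cite: Burgisser2000, Rem. 2.7] -/
def Operand.subst (ρ : σ → Operand k τ) (n : ℕ) : Operand k σ → Operand k τ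
  | .var i => ρ i
  | .const c => .const c
  | .gate j => .gate (j + n)

/-- `Operand.subst` on all operands of a gate. [cite: Burgisser2000, Rem. 2.7] -/
def Gate.subst (ρ : σ → Operand k τ) (n : ℕ) : Gate k σ → Gate k τ
  | .sum args => .sum (args.map fun a => (a.1, a.2.subst ρ n))
  | .prod args => .prod (args.map (Operand.subst ρ n))

/-- **Substitution circuit**: a prefix gate list `pre` (computing the polynomials to be
substituted) followed by the gates of `P` in which every input `X i` is replaced by the operand
`ρ i` reading the prefix (Bürgisser 2000, proof of Prop. 2.3 / Rem. 2.7). [cite: Burgisser2000, Rem. 2.7] -/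
def substCircuit (P : ArithCircuit k σ) (pre : List (Gate k τ)) (ρ : σ → Operand k τ) :
    ArithCircuit k τ where
  gates := pre ++ P.gates.map (Gate.subst ρ pre.length)
  output := P.output.subst ρ pre.length

/-- Size of the substitution circuit: prefix plus `|P|`. [cite: Burgisser2000, Rem. 2.7] -/
@[simp]
theorem size_substCircuit (P : ArithCircuit k σ) (pre : List (Gate k τ)) (ρ : σ → Operand k τ) :
    (P.substCircuit pre ρ).size = pre.length + P.size := by
  simp [substCircuit, size]

/-- Substitution does not change the fan-in of a gate. [folklore] -/
theorem Gate.fanIn_subst (ρ : σ → Operand k τ) (n : ℕ) (g : Gate k σ) :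
    (g.subst ρ n).fanIn = g.fanIn := by
  cases g <;> simp [Gate.subst, Gate.fanIn, Gate.args]

/-- The substitution circuit has fan-in two if the prefix and `P` have. [folklore] -/
theorem IsFanInTwo.substCircuit {P : ArithCircuit k σ} (hP : P.IsFanInTwo) {pre : List (Gate k τ)}
    (hpre : ∀ g ∈ pre, g.fanIn ≤ 2) (ρ : σ → Operand k τ) : (P.substCircuit pre ρ).IsFanInTwo := by
  intro g hg
  simp only [ArithCircuit.substCircuit, List.mem_append, List.mem_map] at hg
  rcases hg with hg | ⟨g', hg', rfl⟩
  · exact hpre g hg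
  · rw [Gate.fanIn_subst]; exact hP g' hg'

/-! ### Juxtaposition of a list of circuits -/

section Juxt

variable [Zero k]

/-- The gates of the juxtaposition of a list of circuits, each shifted past the previous ones. [cite: Burgisser2000, proof of Prop. 2.3] -/
def juxtGates : List (ArithCircuit k τ) → List (Gate k τ)
  | [] => []
  | Q :: L => Q.gates ++ (juxtGates L).map (Gate.shift Q.size)

/-- The output operands of the juxtaposed circuits, as stable operands into `juxtGates`
(truncated at their own circuit, shifted past the previous ones). [cite: Burgisser2000, proof of Prop. 2.3] -/
def juxtOuts : List (ArithCircuit k τ) → List (Operand k τ)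
  | [] => []
  | Q :: L => Q.output.truncate Q.size :: (juxtOuts L).map (Operand.shift Q.size)

omit [Zero k] in
/-- The juxtaposition has as many gates as all the circuits together. [cite: Burgisser2000, proof of Prop. 2.3] -/
theorem length_juxtGates (L : List (ArithCircuit k τ)) :
    (juxtGates L).length = (L.map size).sum := by
  induction L with
  | nil => rfl
  | cons Q L ih => simp [juxtGates, ih, size]

/-- One output operand per circuit. [folklore] -/
@[simp]
theorem length_juxtOuts (L : List (ArithCircuit k τ)) : (juxtOuts L).length = L.length := by
  induction L with
  | nil => rfl
  | cons Q L ih => simp [juxtOuts, ih]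

omit [Zero k] in
/-- The juxtaposition of fan-in-two circuits has fan-in-two gates. [folklore] -/
theorem fanIn_juxtGates {L : List (ArithCircuit k τ)} (hL : ∀ Q ∈ L, Q.IsFanInTwo) :
    ∀ g ∈ juxtGates L, g.fanIn ≤ 2 := by
  induction L with
  | nil => simp [juxtGates]
  | cons Q L ih =>
    intro g hg
    simp only [juxtGates, List.mem_append, List.mem_map] at hg
    rcases hg with hg | ⟨g', hg', rfl⟩
    · exact hL Q (by simp) g hg
    · have : (g'.shift Q.size).fanIn = g'.fanIn := by
        cases g' <;> simp [Gate.shift, Gate.fanIn, Gate.args]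
      rw [this]
      exact ih (fun R hR => hL R (by simp [hR])) g' hg'

end Juxt

section SubstSign

variable [Zero k] [One k] [Add k]

/-- Substituting constant-free operands preserves sign constants of an operand. [cite: Burgisser2000, §1.4] -/
theorem Operand.HasSignConstants.subst {ρ : σ → Operand k τ} (hρ : ∀ i, (ρ i).HasSignConstants)
    (n : ℕ) {u : Operand k σ} (h : u.HasSignConstants) : (u.subst ρ n).HasSignConstants := by
  cases u with
  | var i => exact hρ i
  | const c => exact h
  | gate j => trivial

/-- Substituting constant-free operands preserves sign constants of a gate. [cite: Burgisser2000, §1.4] -/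
theorem Gate.HasSignConstants.subst {ρ : σ → Operand k τ} (hρ : ∀ i, (ρ i).HasSignConstants)
    (n : ℕ) {g : Gate k σ} (h : g.HasSignConstants) : (g.subst ρ n).HasSignConstants := by
  cases g with
  | sum args =>
    intro a ha
    simp only [List.mem_map] at ha
    obtain ⟨b, hb, rfl⟩ := ha
    exact ⟨(h b hb).1, (h b hb).2.subst hρ n⟩
  | prod args =>
    intro u hu
    simp only [List.mem_map] at hu
    obtain ⟨v, hv, rfl⟩ := hu
    exact (h v hv).subst hρ n

/-- The substitution circuit is constant-free if all its ingredients are. [cite: Burgisser2000, §1.4] -/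
theorem HasSignConstants.substCircuit {P : ArithCircuit k σ} (hP : P.HasSignConstants)
    {pre : List (Gate k τ)} (hpre : ∀ g ∈ pre, g.HasSignConstants) {ρ : σ → Operand k τ}
    (hρ : ∀ i, (ρ i).HasSignConstants) : (P.substCircuit pre ρ).HasSignConstants := by
  refine ⟨fun g hg => ?_, hP.2.subst hρ _⟩
  simp only [ArithCircuit.substCircuit, List.mem_append, List.mem_map] at hg
  rcases hg with hg | ⟨g', hg', rfl⟩
  · exact hpre g hg
  · exact (hP.1 g' hg').subst hρ _

/-- The juxtaposition of constant-free circuits has constant-free gates. [cite: Burgisser2000, §1.4] -/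
theorem hasSignConstants_juxtGates {L : List (ArithCircuit k τ)} (hL : ∀ Q ∈ L, Q.HasSignConstants) :
    ∀ g ∈ juxtGates L, g.HasSignConstants := by
  induction L with
  | nil => simp [juxtGates]
  | cons Q L ih =>
    intro g hg
    simp only [juxtGates, List.mem_append, List.mem_map] at hg
    rcases hg with hg | ⟨g', hg', rfl⟩
    · exact (hL Q (by simp)).1 g hg
    · exact (ih (fun R hR => hL R (by simp [hR])) g' hg').shift _

/-- The juxtaposed output operands of constant-free circuits are constant-free. [cite: Burgisser2000, §1.4] -/
theorem hasSignConstants_juxtOuts {L : List (ArithCircuit k τ)} (hL : ∀ Q ∈ L, Q.HasSignConstants) :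
    ∀ u ∈ juxtOuts L, u.HasSignConstants := by
  induction L with
  | nil => simp [juxtOuts]
  | cons Q L ih =>
    intro u hu
    simp only [juxtOuts, List.mem_cons, List.mem_map] at hu
    rcases hu with rfl | ⟨u', hu', rfl⟩
    · exact (hL Q (by simp)).2.truncate _
    · exact (ih (fun R hR => hL R (by simp [hR])) u' hu').shift _

end SubstSign

variable [CommSemiring k]

/-- Semantics of a substituted operand: against `pre ++ (aeval h) vals` it evaluates to
`aeval h` of the original value, provided `ρ i` reads `h i` off the prefix. [cite: Burgisser2000, Rem. 2.7] -/
theorem Operand.eval_subst {ρ : σ → Operand k τ} {pre : List (MvPolynomial τ k)}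
    {h : σ → MvPolynomial τ k} (hρ : ∀ i ws, (ρ i).eval (pre ++ ws) = h i)
    (u : Operand k σ) (vals : List (MvPolynomial σ k)) :
    (u.subst ρ pre.length).eval (pre ++ vals.map (aeval h)) = aeval h (u.eval vals) := by
  cases u with
  | var i =>
    change (ρ i).eval _ = aeval h (X i)
    rw [MvPolynomial.aeval_X]
    exact hρ i _
  | const c => simp [Operand.subst, Operand.eval, MvPolynomial.algebraMap_eq]
  | gate j =>
    simp only [Operand.subst, Operand.eval, List.getD_eq_getElem?_getD]
    rw [List.getElem?_append_right (by omega), Nat.add_sub_cancel, List.getElem?_map]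
    cases vals[j]? <;> simp

/-- Semantics of a substituted gate (`aeval h` is an algebra map, so it commutes with weighted
sums and products). [cite: Burgisser2000, Rem. 2.7] -/
theorem Gate.eval_subst {ρ : σ → Operand k τ} {pre : List (MvPolynomial τ k)}
    {h : σ → MvPolynomial τ k} (hρ : ∀ i ws, (ρ i).eval (pre ++ ws) = h i)
    (g : Gate k σ) (vals : List (MvPolynomial σ k)) :
    (g.subst ρ pre.length).eval (pre ++ vals.map (aeval h)) = aeval h (g.eval vals) := by
  cases g with
  | sum args =>
    simp only [Gate.subst, Gate.eval, List.map_map, map_list_sum]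
    congr 1
    simp [Function.comp_def, Operand.eval_subst hρ]
  | prod args =>
    simp only [Gate.subst, Gate.eval, List.map_map, map_list_prod]
    congr 1
    simp [Function.comp_def, Operand.eval_subst hρ]

/-- The fold over substituted gates, started on the prefix values. [cite: Burgisser2000, Rem. 2.7] -/
theorem foldl_subst {ρ : σ → Operand k τ} {pre : List (MvPolynomial τ k)}
    {h : σ → MvPolynomial τ k} (hρ : ∀ i ws, (ρ i).eval (pre ++ ws) = h i)
    (gs : List (Gate k σ)) (vals : List (MvPolynomial σ k)) :
    (gs.map (Gate.subst ρ pre.length)).foldl (fun vs g => vs ++ [g.eval vs])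
        (pre ++ vals.map (aeval h)) =
      pre ++ (gs.foldl (fun vs g => vs ++ [g.eval vs]) vals).map (aeval h) := by
  induction gs generalizing vals with
  | nil => simp
  | cons g rest ih =>
    simp only [List.map_cons, List.foldl_cons]
    rw [Gate.eval_subst hρ, List.append_assoc,
      show vals.map (aeval h) ++ [aeval h (g.eval vals)] = (vals ++ [g.eval vals]).map (aeval h) by
        simp, ih]

/-- **Semantics of the substitution circuit**: if `ρ i` reads `h i` off the values of the prefix,
then `substCircuit P pre ρ` computes `P.eval (h₁, …)`, i.e. `aeval h P.eval`
(Bürgisser 2000, Rem. 2.7). [cite: Burgisser2000, Rem. 2.7] -/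
theorem eval_substCircuit (P : ArithCircuit k σ) (pre : List (Gate k τ)) {ρ : σ → Operand k τ}
    {h : σ → MvPolynomial τ k} (hρ : ∀ i ws, (ρ i).eval (gateValues pre ++ ws) = h i) :
    (P.substCircuit pre ρ).eval = aeval h P.eval := by
  have hlen : pre.length = (gateValues pre).length := (gateValues_length (k := k) pre).symm
  change (P.output.subst ρ pre.length).eval
      (gateValues (pre ++ P.gates.map (Gate.subst ρ pre.length))) = _
  have hgv : gateValues (pre ++ P.gates.map (Gate.subst ρ pre.length)) =
      gateValues pre ++ (gateValues P.gates).map (aeval h) := by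
    unfold gateValues
    rw [List.foldl_append, hlen]
    have := foldl_subst (k := k) hρ P.gates []
    simpa [gateValues] using this
  rw [hgv, hlen, Operand.eval_subst hρ]
  rfl

/-! ### Semantics of juxtaposition -/

/-- The value list of a juxtaposition is the concatenation of the value lists. [cite: Burgisser2000, proof of Prop. 2.3] -/
theorem gateValues_juxtGates (L : List (ArithCircuit k τ)) :
    gateValues (juxtGates L) = (L.map fun Q => gateValues Q.gates).flatten := by
  induction L with
  | nil => rfl
  | cons Q L ih =>
    simp only [juxtGates, List.map_cons, List.flatten_cons]
    rw [show Q.size = Q.gates.length from rfl, gateValues_append_shift, ih]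

/-- A truncated-then-shifted operand reads the middle block of `pre ++ vals ++ ws`. [folklore] -/
theorem Operand.eval_truncate_shift_append (pre vals ws : List (MvPolynomial τ k))
    (u : Operand k τ) :
    ((u.truncate vals.length).shift pre.length).eval (pre ++ (vals ++ ws)) = u.eval vals := by
  rw [Operand.eval_shift_append, Operand.eval_truncate_append]

/-- **Stability of the juxtaposed outputs**: the `i`-th output operand, read against the values of
the juxtaposition followed by anything, is the value of the `i`-th circuit. [cite: Burgisser2000, proof of Prop. 2.3] -/
theorem eval_juxtOuts (L : List (ArithCircuit k τ)) (i : ℕ) (hi : i < L.length)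
    (ws : List (MvPolynomial τ k)) :
    ((juxtOuts L)[i]'(by simpa using hi)).eval (gateValues (juxtGates L) ++ ws) =
      (L[i]'hi).eval := by
  induction L generalizing i ws with
  | nil => simp at hi
  | cons Q L ih =>
    have hQ : Q.size = (gateValues Q.gates).length := (gateValues_length (k := k) Q.gates).symm
    rw [gateValues_juxtGates]
    simp only [List.map_cons, List.flatten_cons]
    rw [List.append_assoc]
    cases i with
    | zero =>
      have h0 := Operand.eval_truncate_append (gateValues Q.gates)
        ((L.map fun Q => gateValues Q.gates).flatten ++ ws) Q.output
      rw [← hQ] at h0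
      simp only [juxtOuts, List.getElem_cons_zero]
      rw [h0]
      rfl
    | succ i =>
      have hi' : i < L.length := by simpa using hi
      have h1 := Operand.eval_shift_append (gateValues Q.gates)
        ((L.map fun Q => gateValues Q.gates).flatten ++ ws) ((juxtOuts L)[i]'(by simpa using hi'))
      rw [← hQ] at h1
      simp only [juxtOuts, List.getElem_cons_succ, List.getElem_map]
      rw [h1, ← gateValues_juxtGates]
      exact ih i hi' ws

end Subst

/-! ### Constant-free circuits for integers and attainment of `τ` over `ℤ` -/

section Integers

/-- A constant-free fan-in-two circuit for the natural number `m`: `0`, and `m + 1 = m + 1`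
(one sum gate per unit; Bürgisser 2009, §2.2: `τ(k) ≤ 2 log k` would be the optimal bound, the
linear one suffices for attainment). [cite: Burgisser2000, §1.4] -/
def natCircuit : ℕ → ArithCircuit ℤ σ
  | 0 => ofConst 0
  | m + 1 => (natCircuit m).add (ofConst 1)

/-- `natCircuit m` computes the constant `m`. [cite: Burgisser2000, §1.4] -/
theorem eval_natCircuit (m : ℕ) : (natCircuit m : ArithCircuit ℤ σ).eval = (m : MvPolynomial σ ℤ) := by
  induction m with
  | zero => simp [natCircuit]
  | succ m ih => rw [natCircuit, add_eval, ih, eval_ofConst]; simp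

/-- `natCircuit m` has fan-in two. [folklore] -/
theorem isFanInTwo_natCircuit (m : ℕ) : (natCircuit m : ArithCircuit ℤ σ).IsFanInTwo := by
  induction m with
  | zero => exact IsFanInTwo.ofConst 0
  | succ m ih => exact ih.add (IsFanInTwo.ofConst 1)

/-- `natCircuit m` is constant-free. [cite: Burgisser2000, §1.4] -/
theorem hasSignConstants_natCircuit (m : ℕ) : (natCircuit m : ArithCircuit ℤ σ).HasSignConstants := by
  induction m with
  | zero => exact (hasSignConstants_ofConst_iff (0 : ℤ)).2 isSignConstant_zero
  | succ m ih => exact ih.add ((hasSignConstants_ofConst_iff (1 : ℤ)).2 isSignConstant_one)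

/-- **Discharge of `ArithCircuit.exists_computes_hasSignConstants`**: every integer polynomial is
computed by some fan-in-two constant-free circuit (integer coefficients are iterated sums of `1`,
negated by the coefficient `-1`; then sums and products of monomials) (Bürgisser 2000 §1.4;
Malod 2003). [cite: Burgisser2000, §1.4] -/
theorem exists_computes_hasSignConstants_holds : exists_computes_hasSignConstants (σ := σ) := by
  intro f
  induction f using MvPolynomial.induction_on with
  | C a =>
    rcases le_or_gt 0 a with ha | ha
    · refine ⟨natCircuit a.toNat, isFanInTwo_natCircuit _, hasSignConstants_natCircuit _, ?_⟩
      rw [Computes, eval_natCircuit, ← map_natCast (C : ℤ →+* MvPolynomial σ ℤ), Int.natCast_toNat_eq_self.2 ha]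
    · refine ⟨(natCircuit a.natAbs).smul (-1), (isFanInTwo_natCircuit _).smul,
        (hasSignConstants_natCircuit _).smul isSignConstant_neg_one, ?_⟩
      rw [Computes, eval_smul, eval_natCircuit]
      have : (a.natAbs : ℤ) = -a := Int.ofNat_natAbs_of_nonpos ha.le
      rw [show (a.natAbs : MvPolynomial σ ℤ) = C (a.natAbs : ℤ) by simp, this]
      simp
  | add p q hp hq =>
    obtain ⟨P, hP1, hP2, hP3⟩ := hp
    obtain ⟨Q, hQ1, hQ2, hQ3⟩ := hq
    refine ⟨P.add Q, hP1.add hQ1, hP2.add hQ2, ?_⟩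
    rw [Computes] at hP3 hQ3 ⊢
    rw [add_eval, hP3, hQ3]
  | mul_X p i hp =>
    obtain ⟨P, hP1, hP2, hP3⟩ := hp
    refine ⟨P.mul (ofVar i), hP1.mul (IsFanInTwo.ofVar i), hP2.mul (HasSignConstants.ofVar i), ?_⟩
    rw [Computes] at hP3 ⊢
    rw [mul_eval, hP3, eval_ofVar]

/-- `τ f` is attained over `ℤ`: some fan-in-two constant-free circuit of size exactly `τ f`
computes `f` (no `sInf ∅` junk). [cite: Burgisser2000, §1.4] -/
theorem exists_computes_size_eq_constantFreeComplexity (f : MvPolynomial σ ℤ) :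
    ∃ P : ArithCircuit ℤ σ, P.IsFanInTwo ∧ P.HasSignConstants ∧ P.Computes f ∧
      P.size = constantFreeComplexity f := by
  obtain ⟨P, h1, h2, h3⟩ := exists_computes_hasSignConstants_holds (σ := σ) f
  exact Nat.sInf_mem (⟨P.size, P, h1, h2, h3, rfl⟩ : Set.Nonempty {s | ∃ P : ArithCircuit ℤ σ,
    P.IsFanInTwo ∧ P.HasSignConstants ∧ P.Computes f ∧ P.size = s})

end Integers

/-- The defining inequality: any fan-in-two constant-free circuit computing `f` bounds `τ f` by
its size (Bürgisser 2000, §1.4). [cite: Burgisser2000, §1.4] -/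
theorem constantFreeComplexity_le_size [CommSemiring k] {P : ArithCircuit k σ}
    {f : MvPolynomial σ k} (h2 : P.IsFanInTwo) (hs : P.HasSignConstants) (hf : P.Computes f) :
    constantFreeComplexity f ≤ P.size :=
  Nat.sInf_le ⟨P, h2, hs, hf, rfl⟩

end ArithCircuit

/-! ### The cost calculus of `τ` over `ℤ` -/

section TauCalculus

variable {σ : Type v} {τ : Type w}

open ArithCircuit

/-- **Discharge of `complexity_le_constantFreeComplexity`**: `L(f) ≤ τ(f)` whenever some
constant-free circuit computes `f` (a minimal constant-free circuit is a circuit)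
(Bürgisser 2000 §1.4). [cite: Burgisser2000, §1.4] -/
theorem complexity_le_constantFreeComplexity_holds {k : Type u} [CommSemiring k] :
    complexity_le_constantFreeComplexity (k := k) (σ := σ) := by
  intro f hf
  obtain ⟨P₀, h₀, h₀', h₀''⟩ := hf
  have hne : {s | ∃ P : ArithCircuit k σ, P.IsFanInTwo ∧ P.HasSignConstants ∧ P.Computes f ∧
      P.size = s}.Nonempty := ⟨P₀.size, P₀, h₀, h₀', h₀'', rfl⟩
  obtain ⟨P, hP, -, hPf, hPs⟩ := Nat.sInf_mem hne
  calc complexity f ≤ P.size := complexity_le_size hP hPf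
    _ = constantFreeComplexity f := hPs

/-- `τ(f + g) ≤ τ f + τ g + 1` (Bürgisser 2000, §1.4/§2.1). [cite: Burgisser2000, §2.1] -/
theorem constantFreeComplexity_add_le (f g : MvPolynomial σ ℤ) :
    constantFreeComplexity (f + g) ≤ constantFreeComplexity f + constantFreeComplexity g + 1 := by
  obtain ⟨P, hP1, hP2, hP3, hP4⟩ := exists_computes_size_eq_constantFreeComplexity f
  obtain ⟨Q, hQ1, hQ2, hQ3, hQ4⟩ := exists_computes_size_eq_constantFreeComplexity g
  rw [← hP4, ← hQ4, ← size_add P Q]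
  refine constantFreeComplexity_le_size (hP1.add hQ1) (hP2.add hQ2) ?_
  rw [Computes] at hP3 hQ3 ⊢
  rw [add_eval, hP3, hQ3]

/-- `τ(f g) ≤ τ f + τ g + 1` (Bürgisser 2000, §1.4/§2.1). [cite: Burgisser2000, §2.1] -/
theorem constantFreeComplexity_mul_le (f g : MvPolynomial σ ℤ) :
    constantFreeComplexity (f * g) ≤ constantFreeComplexity f + constantFreeComplexity g + 1 := by
  obtain ⟨P, hP1, hP2, hP3, hP4⟩ := exists_computes_size_eq_constantFreeComplexity f
  obtain ⟨Q, hQ1, hQ2, hQ3, hQ4⟩ := exists_computes_size_eq_constantFreeComplexity g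
  rw [← hP4, ← hQ4, ← size_mul P Q]
  refine constantFreeComplexity_le_size (hP1.mul hQ1) (hP2.mul hQ2) ?_
  rw [Computes] at hP3 hQ3 ⊢
  rw [mul_eval, hP3, hQ3]

/-- `τ(-f) ≤ τ f + 1` (one sum gate with coefficient `-1`; Bürgisser 2000, §1.4). [cite: Burgisser2000, §1.4] -/
theorem constantFreeComplexity_neg_le (f : MvPolynomial σ ℤ) :
    constantFreeComplexity (-f) ≤ constantFreeComplexity f + 1 := by
  obtain ⟨P, hP1, hP2, hP3, hP4⟩ := exists_computes_size_eq_constantFreeComplexity f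
  rw [← hP4, ← size_smul (-1 : ℤ) P]
  refine constantFreeComplexity_le_size hP1.smul (hP2.smul isSignConstant_neg_one) ?_
  rw [Computes] at hP3 ⊢
  rw [eval_smul, hP3, neg_one_smul]

/-- `τ(f - g) ≤ τ f + τ g + 2` (Bürgisser 2000, §1.4). [cite: Burgisser2000, §1.4] -/
theorem constantFreeComplexity_sub_le (f g : MvPolynomial σ ℤ) :
    constantFreeComplexity (f - g) ≤ constantFreeComplexity f + constantFreeComplexity g + 2 := by
  rw [sub_eq_add_neg]
  calc constantFreeComplexity (f + -g)
      ≤ constantFreeComplexity f + constantFreeComplexity (-g) + 1 := constantFreeComplexity_add_le _ _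
    _ ≤ constantFreeComplexity f + (constantFreeComplexity g + 1) + 1 := by
        gcongr; exact constantFreeComplexity_neg_le g
    _ = _ := by ring

/-- `τ(f²) ≤ τ f + 1` (one product gate reading `f` twice; Koiran 2004, §1). [cite: Koiran2004, §1] -/
theorem constantFreeComplexity_sq_le (f : MvPolynomial σ ℤ) :
    constantFreeComplexity (f ^ 2) ≤ constantFreeComplexity f + 1 := by
  obtain ⟨P, hP1, hP2, hP3, hP4⟩ := exists_computes_size_eq_constantFreeComplexity f
  rw [← hP4, ← size_square P]
  refine constantFreeComplexity_le_size hP1.square hP2.square ?_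
  rw [Computes] at hP3 ⊢
  rw [square_eval, hP3]

/-- Repeated squaring: `τ(f^(2^i)) ≤ τ f + i` (Koiran 2004, §1; Bürgisser 2009, proof of
Thm. 4.1: the substitution `X^{2^i}`, `2^{2^i}` costs `O(ℓ)` gates). [cite: Koiran2004, §1] -/
theorem constantFreeComplexity_pow_two_pow_le (f : MvPolynomial σ ℤ) (i : ℕ) :
    constantFreeComplexity (f ^ 2 ^ i) ≤ constantFreeComplexity f + i := by
  induction i with
  | zero => simp
  | succ i ih =>
    rw [pow_succ, pow_mul]
    calc constantFreeComplexity ((f ^ 2 ^ i) ^ 2) ≤ constantFreeComplexity (f ^ 2 ^ i) + 1 :=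
          constantFreeComplexity_sq_le _
      _ ≤ constantFreeComplexity f + i + 1 := by gcongr
      _ = _ := by ring

/-- Variables are free: `τ(X i) = 0`. [cite: Burgisser2000, Def. 2.1] -/
@[simp]
theorem constantFreeComplexity_X (i : σ) : constantFreeComplexity (X i : MvPolynomial σ ℤ) = 0 :=
  Nat.eq_zero_of_le_zero (constantFreeComplexity_le_size (IsFanInTwo.ofVar i)
    (HasSignConstants.ofVar i) rfl)

/-- Sign constants are free: `τ(C c) = 0` for `c ∈ {0, 1, -1}`. [cite: Burgisser2000, §1.4] -/
theorem constantFreeComplexity_C_of_isSignConstant {c : ℤ} (hc : ArithCircuit.IsSignConstant c) :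
    constantFreeComplexity (C c : MvPolynomial σ ℤ) = 0 :=
  Nat.eq_zero_of_le_zero (constantFreeComplexity_le_size (IsFanInTwo.ofConst c)
    ((hasSignConstants_ofConst_iff c).2 hc) rfl)

/-- `τ(1) = 0`. [cite: Burgisser2000, §1.4] -/
@[simp]
theorem constantFreeComplexity_one : constantFreeComplexity (1 : MvPolynomial σ ℤ) = 0 := by
  rw [← C_1]; exact constantFreeComplexity_C_of_isSignConstant isSignConstant_one

/-- `τ(0) = 0`. [cite: Burgisser2000, §1.4] -/
@[simp]
theorem constantFreeComplexity_zero : constantFreeComplexity (0 : MvPolynomial σ ℤ) = 0 := by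
  rw [← C_0]; exact constantFreeComplexity_C_of_isSignConstant isSignConstant_zero

/-- `τ(-1) = 0`. [cite: Burgisser2000, §1.4] -/
theorem constantFreeComplexity_C_neg_one : constantFreeComplexity (C (-1) : MvPolynomial σ ℤ) = 0 :=
  constantFreeComplexity_C_of_isSignConstant isSignConstant_neg_one

/-- `τ(2) ≤ 1` (`2 = 1 + 1`). [cite: Burgisser2009, §2.2] -/
theorem constantFreeComplexity_C_two_le : constantFreeComplexity (C 2 : MvPolynomial σ ℤ) ≤ 1 := by
  have h := constantFreeComplexity_add_le (1 : MvPolynomial σ ℤ) 1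
  rw [constantFreeComplexity_one] at h
  rw [show (C 2 : MvPolynomial σ ℤ) = 1 + 1 by rw [← C_1, ← C_add]; norm_num]
  simpa using h

/-- `τ(2^(2^i)) ≤ i + 1` by repeated squaring (Koiran 2004, §1: `τ(2^{2^k}) = k + 1`;
Bürgisser 2009, proof of Thm. 4.1). [cite: Koiran2004, §1] -/
theorem constantFreeComplexity_C_two_pow_two_pow_le (i : ℕ) :
    constantFreeComplexity (C ((2 : ℤ) ^ 2 ^ i) : MvPolynomial σ ℤ) ≤ i + 1 := by
  rw [C_pow]
  calc constantFreeComplexity ((C 2 : MvPolynomial σ ℤ) ^ 2 ^ i)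
      ≤ constantFreeComplexity (C 2 : MvPolynomial σ ℤ) + i := constantFreeComplexity_pow_two_pow_le _ _
    _ ≤ 1 + i := by gcongr; exact constantFreeComplexity_C_two_le
    _ = i + 1 := by ring

/-- `τ(X_i^(2^j)) ≤ j` by repeated squaring (Bürgisser 2009, proof of Thm. 4.1(2): the
substitution `Z_i ↦ X^{2^{i-1}}`). [cite: Burgisser2009, proof of Thm. 4.1(2)] -/
theorem constantFreeComplexity_X_pow_two_pow_le (i : σ) (j : ℕ) :
    constantFreeComplexity ((X i : MvPolynomial σ ℤ) ^ 2 ^ j) ≤ j := by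
  simpa using constantFreeComplexity_pow_two_pow_le (X i : MvPolynomial σ ℤ) j

/-- Binary powering of the constant `2`: `τ(2^m) ≤ 3 (log₂ m + 1)` (square, and multiply by `2`
on the set bits; Bürgisser 2009, §2.2: `τ(k) ≤ 2 log k`). [cite: Burgisser2009, §2.2] -/
theorem constantFreeComplexity_C_two_pow_le (m : ℕ) :
    constantFreeComplexity (C ((2 : ℤ) ^ m) : MvPolynomial σ ℤ) ≤ 3 * (Nat.log 2 m + 1) := by
  induction m using Nat.strong_induction_on with
  | _ m ih =>
    rcases Nat.lt_or_ge m 2 with hm | hm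
    · obtain rfl | rfl : m = 0 ∨ m = 1 := by omega
      · simp
      · simpa using (constantFreeComplexity_C_two_le (σ := σ)).trans (by norm_num)
    · -- `m = 2 m' + b`
      set m' := m / 2 with hm'
      set b := m % 2 with hb
      have hdecomp : m = 2 * m' + b := (Nat.div_add_mod m 2).symm
      have hm'lt : m' < m := Nat.div_lt_self (by omega) one_lt_two
      have hm'pos : 1 ≤ m' := by omega
      have hlog : Nat.log 2 m = Nat.log 2 m' + 1 := by
        rw [hm', Nat.log_div_base, Nat.sub_add_cancel]
        exact Nat.log_pos one_lt_two hm
      have ih' := ih m' hm'lt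
      -- `2^m = (2^{m'})^2 * 2^b`
      have hpow : (C ((2 : ℤ) ^ m) : MvPolynomial σ ℤ) = (C ((2 : ℤ) ^ m')) ^ 2 * C ((2 : ℤ) ^ b) := by
        rw [← C_pow, ← C_mul, ← pow_mul, ← pow_add, hdecomp, mul_comm]
      rw [hpow]
      have hbτ : constantFreeComplexity (C ((2 : ℤ) ^ b) : MvPolynomial σ ℤ) ≤ 1 := by
        rcases Nat.mod_two_eq_zero_or_one m with h0 | h1
        · rw [← hb] at h0; rw [h0]; simp
        · rw [← hb] at h1; rw [h1]; simpa using constantFreeComplexity_C_two_le (σ := σ)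
      calc constantFreeComplexity ((C ((2 : ℤ) ^ m') : MvPolynomial σ ℤ) ^ 2 * C ((2 : ℤ) ^ b))
          ≤ constantFreeComplexity ((C ((2 : ℤ) ^ m') : MvPolynomial σ ℤ) ^ 2) +
              constantFreeComplexity (C ((2 : ℤ) ^ b) : MvPolynomial σ ℤ) + 1 :=
            constantFreeComplexity_mul_le _ _
        _ ≤ (constantFreeComplexity (C ((2 : ℤ) ^ m') : MvPolynomial σ ℤ) + 1) + 1 + 1 := by
            gcongr
            exact constantFreeComplexity_sq_le _
        _ ≤ (3 * (Nat.log 2 m' + 1) + 1) + 1 + 1 := by gcongr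
        _ = 3 * (Nat.log 2 m + 1) := by rw [hlog]; ring

/-- Iterated subadditivity: `τ(∑_{i ∈ s} fᵢ) ≤ ∑_{i ∈ s} τ(fᵢ) + #s`. [cite: Burgisser2000, §2.1] -/
theorem constantFreeComplexity_finset_sum_le {ι : Type*} (s : Finset ι) (f : ι → MvPolynomial σ ℤ) :
    constantFreeComplexity (∑ i ∈ s, f i) ≤ ∑ i ∈ s, constantFreeComplexity (f i) + s.card := by
  classical
  induction s using Finset.induction_on with
  | empty => simp
  | insert a s ha ih =>
    rw [Finset.sum_insert ha, Finset.sum_insert ha, Finset.card_insert_of_notMem ha]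
    calc constantFreeComplexity (f a + ∑ i ∈ s, f i)
        ≤ constantFreeComplexity (f a) + constantFreeComplexity (∑ i ∈ s, f i) + 1 :=
          constantFreeComplexity_add_le _ _
      _ ≤ constantFreeComplexity (f a) + (∑ i ∈ s, constantFreeComplexity (f i) + s.card) + 1 := by
          gcongr
      _ = _ := by ring

/-- Iterated submultiplicativity: `τ(∏_{i ∈ s} fᵢ) ≤ ∑_{i ∈ s} τ(fᵢ) + #s`. [cite: Burgisser2000, §2.1] -/
theorem constantFreeComplexity_finset_prod_le {ι : Type*} (s : Finset ι) (f : ι → MvPolynomial σ ℤ) :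
    constantFreeComplexity (∏ i ∈ s, f i) ≤ ∑ i ∈ s, constantFreeComplexity (f i) + s.card := by
  classical
  induction s using Finset.induction_on with
  | empty => simp
  | insert a s ha ih =>
    rw [Finset.prod_insert ha, Finset.sum_insert ha, Finset.card_insert_of_notMem ha]
    calc constantFreeComplexity (f a * ∏ i ∈ s, f i)
        ≤ constantFreeComplexity (f a) + constantFreeComplexity (∏ i ∈ s, f i) + 1 :=
          constantFreeComplexity_mul_le _ _
      _ ≤ constantFreeComplexity (f a) + (∑ i ∈ s, constantFreeComplexity (f i) + s.card) + 1 := by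
          gcongr
      _ = _ := by ring

/-- Renaming variables does not increase `τ` (rename a minimal circuit; Bürgisser 2000,
Rem. 2.2). [cite: Burgisser2000, Rem. 2.2] -/
theorem constantFreeComplexity_rename_le (e : σ → τ) (f : MvPolynomial σ ℤ) :
    constantFreeComplexity (MvPolynomial.rename e f) ≤ constantFreeComplexity f := by
  obtain ⟨P, hP1, hP2, hP3, hP4⟩ := exists_computes_size_eq_constantFreeComplexity f
  rw [← hP4, ← size_rename e P]
  exact constantFreeComplexity_le_size (hP1.rename e) (hP2.rename e) (hP3.rename e)

/-- **Substitution bound for `τ`**: `τ(f(g₁, …, g_m)) ≤ τ(f) + ∑ᵢ τ(gᵢ)` — juxtapose minimal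
circuits for the `gᵢ` and plug their outputs into the inputs of a minimal circuit for `f`
(Bürgisser 2000, proof of Prop. 2.3 and Rem. 2.7, for `L`; the construction introduces no
constants, so it holds verbatim for `τ`). [cite: Burgisser2000, Rem. 2.7] -/
theorem constantFreeComplexity_aeval_le [Fintype σ] (f : MvPolynomial σ ℤ)
    (g : σ → MvPolynomial τ ℤ) :
    constantFreeComplexity (aeval g f) ≤ constantFreeComplexity f + ∑ i, constantFreeComplexity (g i) := by
  classical
  -- minimal circuits
  obtain ⟨P, hP1, hP2, hP3, hP4⟩ := exists_computes_size_eq_constantFreeComplexity f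
  choose Q hQ1 hQ2 hQ3 hQ4 using fun i => exists_computes_size_eq_constantFreeComplexity (g i)
  -- enumerate the variables and juxtapose the `Q i`
  set m := Fintype.card σ
  set e : σ ≃ Fin m := Fintype.equivFin σ
  set L : List (ArithCircuit ℤ τ) := List.ofFn fun j : Fin m => Q (e.symm j) with hL
  have hLlen : L.length = m := by simp [hL]
  have hmemL : ∀ R ∈ L, ∃ i, R = Q i := fun R hR => by
    simp only [hL, List.mem_ofFn] at hR
    obtain ⟨j, rfl⟩ := hR
    exact ⟨_, rfl⟩
  set ρ : σ → Operand ℤ τ := fun i => (juxtOuts L)[(e i : ℕ)]'(by simp [hLlen]) with hρ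
  have hρeval : ∀ i ws, (ρ i).eval (gateValues (juxtGates L) ++ ws) = g i := fun i ws => by
    have hi : ((e i : ℕ)) < L.length := by simp [hLlen]
    have h := eval_juxtOuts L (e i) hi ws
    simp only [hρ]
    rw [h]
    have : L[(e i : ℕ)]'hi = Q i := by simp [hL, List.getElem_ofFn]
    rw [this]
    exact hQ3 i
  -- the substitution circuit
  have hcomp : (P.substCircuit (juxtGates L) ρ).Computes (aeval g f) := by
    rw [Computes] at hP3 ⊢
    rw [eval_substCircuit P (juxtGates L) hρeval, hP3]
  have hfan : (P.substCircuit (juxtGates L) ρ).IsFanInTwo :=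
    hP1.substCircuit (fanIn_juxtGates fun R hR => by
      obtain ⟨i, rfl⟩ := hmemL R hR; exact hQ1 i) ρ
  have hsign : (P.substCircuit (juxtGates L) ρ).HasSignConstants :=
    hP2.substCircuit (hasSignConstants_juxtGates fun R hR => by
      obtain ⟨i, rfl⟩ := hmemL R hR; exact hQ2 i) fun i =>
        hasSignConstants_juxtOuts (fun R hR => by obtain ⟨i, rfl⟩ := hmemL R hR; exact hQ2 i) _
          (List.getElem_mem _)
  refine (constantFreeComplexity_le_size hfan hsign hcomp).trans (le_of_eq ?_)
  rw [size_substCircuit, length_juxtGates, hP4, add_comm]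
  congr 1
  rw [hL, List.map_ofFn, List.sum_ofFn]
  simp only [Function.comp_def, hQ4]
  exact Fintype.sum_equiv e.symm _ _ fun j => rfl

/-- Scaling by a computed constant: `τ(c • f) ≤ τ(C c) + τ(f) + 1`. [cite: Burgisser2000, §2.1] -/
theorem constantFreeComplexity_C_mul_le (c : ℤ) (f : MvPolynomial σ ℤ) :
    constantFreeComplexity (C c * f) ≤
      constantFreeComplexity (C c : MvPolynomial σ ℤ) + constantFreeComplexity f + 1 :=
  constantFreeComplexity_mul_le _ _

end TauCalculus

end Literature.Computability.AlgebraicComplexity
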